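import Summits.CriticalPhenomena.PercolationContinuityZ3.Theorems.Transplant.FKConnectivityAllQCountReweightedAGlocLogConvex
import HarnessLib

/-!
# The chain link (GEN) for count-reweighted product measures: the node `GENLogConvexPos` (NOT asserted) and the kernel reductions
# (GEN)_μ ⇒ (AG-loc)_μ ⇒ additive gluing, hence `GENLogConvexPos → AGlocLogConvexPos → AdditiveGluingLogConvexPos`

Support file (`--supports stmt-CriticalPhenomena-4575`), FK sub-lane `prim-bschramm-fk-1` (gen 14, completing a gen-13 request) of the
post-continuity programme; builds on p205010 (kernel theorem, internal audit signed; external expert review pending).  One definition with the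
measure as a parameter (`GENUnder`), one `@[conjecture]` node (NOT asserted), proofs; no named facts, no sorries; standard axioms.

(GEN) is the finite link of the p205010 chain above (AG-loc) (Kozma–Nitzan's generalised form, Conj. 4 / Thm. 10: for a monotone nonnegative
set function `F` and a rank of the relays compatible with `a ↦ E F(C_a)`,
`Σ_a μ(P^o_a)·E F(C_a) ≤ ∫_{o ↔ A} F(C_o)`), here named for ANY measure: `GENUnder μ A o` — exactly the hypothesis of fk-2's measure-generic
reduction `FK.agloc_firstRank_of_gen_under` (`…FKUpperChain.lean`), which yields (AG-loc)_μ (`aglocUnder_of_genUnder`), whence additive gluing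
(`additiveGluingUnder_of_aglocUnder`, g13).
NODE `GENLogConvexPos`: (GEN) for every count-reweighted measure `μ_h ∝ P_w·h(k)` (`crMeasure w h`) with `h > 0` LOG-CONVEX — NOT asserted;
**`aglocLogConvexPos_of_genLogConvexPos : GENLogConvexPos → AGlocLogConvexPos`**, `additiveGluingLogConvexPos_of_genLogConvexPos`,
`additiveGluingFKPos_of_genLogConvexPos` are kernel implications.
EVIDENCE (fk-1 g13 kit j134971, exact integers; memo bschramm/FROM-fk-1-g13-TWO-CLUSTER.md §6): (GEN) exactly as in Lean, adversarial universe
(36,000 near-deterministic weighted graphs, n = 6..9), all observers, all relay sets `|A| ≤ 4`, an F-battery of 12–14 monotone functionals,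
33 log-convex count weights: 0 failures / 13,737,456,000 cells (`|A| = 1` = singleton cluster association 0 / 1,458,926,400); log-concave controls
fail 6.7·10⁸ times.  With fk-1 g10's `logConvex_of_hub_all` (necessity at `|A| = 1` one level down) the log-convex cone is, on all evidence, the
exact class of count reweightings on which the chain from (GEN) down survives.
[cite: KozmaNitzan2024, Conj. 4 (p. 32), Thm. 10 (p. 32); Conj. 1 (p. 3)] [cite: Grimmett2006, §1.4 eq. (1.20) (p. 15); §3.9 (pp. 63–65)]
-/

noncomputable section

namespace Summit.CriticalPhenomena.PercolationContinuityZ3.Theorems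

namespace FK

open MeasureTheory Set Literature.Probability.LatticeModels Literature.Probability.Percolation
open scoped Classical

variable {n : ℕ}

/-! ### (GEN) with the measure as a parameter -/

/-- **(GEN) under `μ`** for the relay set `A` and observer `o`: for every monotone nonnegative set function `F` and every rank `r` injective on
`A` and compatible with `a ↦ ∫ F(C_a) dμ`, `Σ_{a ∈ A} μ({o ↔ a} ∩ ⋂_{a' ∈ A, r a' < r a} {o ↮ a'})·∫ F(C_a) dμ ≤ ∫_{o ↔ A} F(C_o) dμ`.
For `μ = prodBernoulli w` this is Kozma–Nitzan's (GEN); it is the hypothesis of `FK.agloc_firstRank_of_gen_under`.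
[cite: KozmaNitzan2024, Conj. 4 (p. 32), Thm. 10 (p. 32)] -/
def GENUnder (μ : Measure (BondConfig (Fin n))) (A : Finset (Fin n)) (o : Fin n) : Prop :=
  ∀ (F : Set (Fin n) → ℝ) (r : Fin n → ℕ), (∀ S T : Set (Fin n), S ⊆ T → F S ≤ F T) → (∀ S, 0 ≤ F S) → Set.InjOn r ↑A →
    (∀ a ∈ A, ∀ a' ∈ A, r a < r a' → ∫ ω, F (openCluster ω a) ∂μ ≤ ∫ ω, F (openCluster ω a') ∂μ) →
    ∑ a ∈ A, μ.real (openConn o a ∩ ⋂ a' ∈ A.filter (fun a' => r a' < r a), (openConn o a')ᶜ : Set (BondConfig (Fin n))) *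
        ∫ ω, F (openCluster ω a) ∂μ ≤
      ∫ ω in (⋃ a ∈ A, openConn o a), F (openCluster ω o) ∂μ

/-- **(GEN)_μ ⇒ (AG-loc)_μ, for ANY probability measure** (fk-2's `agloc_firstRank_of_gen_under` with `F = 1{b ∈ ·}`).
[cite: KozmaNitzan2024, Conj. 4 (p. 32), Thm. 10 (p. 32)] -/
theorem aglocUnder_of_genUnder (μ : Measure (BondConfig (Fin n))) [IsProbabilityMeasure μ] (hgen : ∀ (A : Finset (Fin n)) (o : Fin n), GENUnder μ A o)
    (A : Finset (Fin n)) (o b : Fin n) : AGlocUnder μ A o b := by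
  intro r hr hcompat
  exact agloc_firstRank_of_gen_under μ A.card (fun A' o' F r' _ hF hF0 hr' hcomp => hgen A' o' F r' hF hF0 hr' hcomp) A o b r le_rfl hr hcompat

/-- **(GEN)_μ ⇒ additive gluing under `μ`** (through (AG-loc)_μ). [cite: KozmaNitzan2024, Conj. 1 (p. 3); Conj. 4 (p. 32)] -/
theorem additiveGluingUnder_of_genUnder (μ : Measure (BondConfig (Fin n))) [IsProbabilityMeasure μ]
    (hgen : ∀ (A : Finset (Fin n)) (o : Fin n), GENUnder μ A o) (A : Finset (Fin n)) (o b : Fin n) : AdditiveGluingUnder μ A o b :=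
  additiveGluingUnder_of_aglocUnder μ A o b (aglocUnder_of_genUnder μ hgen A o b)

/-! ### The node: (GEN) for every log-convex count weight -/

/-- **(GEN) under every positive log-convex count reweighting of product measure**, on every finite weighted graph, every relay set and
observer.  CONJECTURE-SHAPED STATEMENT, NOT asserted.  Evidence (fk-1 g13 kit j134971, exact): 0 failures in 13,737,456,000 cells on the
adversarial universe (n ≤ 9, |A| ≤ 4, 12–14 monotone F, 33 log-convex weights); log-concave controls fail.  Implies `AGlocLogConvexPos`
(`aglocLogConvexPos_of_genLogConvexPos`) and `AdditiveGluingLogConvexPos`. [cite: KozmaNitzan2024, Conj. 4 (p. 32)] [cite: Grimmett2006, §3.9 (pp. 63–65)] -/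
@[conjecture] def GENLogConvexPos : Prop :=
  ∀ (n : ℕ) (w : Sym2 (Fin n) → unitInterval) (h : ℕ → ℝ), (∀ k, 0 < h k) → (∀ j, h (j + 1) * h (j + 1) ≤ h j * h (j + 2)) →
    ∀ (A : Finset (Fin n)) (o : Fin n), GENUnder (crMeasure w h) A o

/-- **`GENLogConvexPos → AGlocLogConvexPos`.** [cite: KozmaNitzan2024, Conj. 4 (p. 32), Thm. 10 (p. 32)] -/
theorem aglocLogConvexPos_of_genLogConvexPos (hgen : GENLogConvexPos) : AGlocLogConvexPos := by
  intro n w h hpos hlc A o b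
  haveI := isProbabilityMeasure_crMeasure w hpos
  exact aglocUnder_of_genUnder (crMeasure w h) (fun A' o' => hgen n w h hpos hlc A' o') A o b

/-- **`GENLogConvexPos → AdditiveGluingLogConvexPos`.** [cite: KozmaNitzan2024, Conj. 1 (p. 3)] -/
theorem additiveGluingLogConvexPos_of_genLogConvexPos (hgen : GENLogConvexPos) : AdditiveGluingLogConvexPos :=
  additiveGluingLogConvexPos_of_aglocLogConvexPos (aglocLogConvexPos_of_genLogConvexPos hgen)

/-- **… hence also `AdditiveGluingFKPos`** (random-cluster weights `q^k` are log-convex). [cite: Grimmett2006, §1.4 eq. (1.20) (p. 15)] -/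
theorem additiveGluingFKPos_of_genLogConvexPos (hgen : GENLogConvexPos) : AdditiveGluingFKPos :=
  additiveGluingFKPos_of_aglocLogConvexPos (aglocLogConvexPos_of_genLogConvexPos hgen)

end FK

end Summit.CriticalPhenomena.PercolationContinuityZ3.Theorems

end
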